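import Summits.CriticalPhenomena.Ising3DConformalLimit.Theses.VolterraWard
import Summits.CriticalPhenomena.Ising3DConformalLimit.Theorems.MonotoneBlockingLimitsAreConformalSummit
import Summits.CriticalPhenomena.Ising3DConformalLimit.Theorems.PerfectScreeningMoebiusLimitExistsTwoLeaf
import HarnessLib

/-!
# Route `VolterraWard` is RESTATED; its deciding crux `TwistFluxConservation` (stmt-CriticalPhenomena-11222) is
# decoration — the certificate (crux-strategist r1, `planner-cstrat-stmt-CriticalPhenomena-11222-r1-0`, 2026-08-17)

Pure assembly over landed theorems (no definitions, no `sorry`).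

1. `hub_*_iff` — the route's three shared hub decls are the `HyperoctahedralRP` items 1981 / 1982 / 0636 verbatim
   (`Iff.rfl`).
2. `summit_of_hubs`, `hubs_iff_summit` — the route's `closes` conclusion `Ising3DConformalLimit` follows from those
   three binders ALONE, and conversely: the load-bearing cone of `VolterraWard.closes` is
   `1981 ∧ 1982 ∧ 0636 ↔ Ising3DConformalLimit` (tree: `LimitsAreConformalSummit.summit_iff_three_hubs`).
3. `assembly_ignoring_volterra : VolterraWard.Assembly` — the route's assembly item (stmt-CriticalPhenomena-7044)
   holds with its seven Volterra antecedents (`CoreTransparency`, `TwistFluxConservation`,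
   `WallCrossingContinuity`, `WallDecay`, `VolterraGlue`, `AxialRotationToO3`, `LimitContinuous`) IGNORED.
4. `closes_of_hubs_only` — the exact type of the route's deciding theorem, re-proved consuming 3 of its 11 binders.
5. `volterra_output_in_tree` — what the Volterra block was built to deliver (rotation invariance, in particular
   invariance under the rotations about `e₃`, of the limit witness of `ExistsScaleCovariantLimit`) is the tree
   theorem `MoebiusLimitExistsTwoLeaf.isRotationInvariant_of_scaleCovariantLimit` (items 1979 + 1980 proved).
-/

namespace Summit.CriticalPhenomena.Ising3DConformalLimit.Cruxes.TwistFluxConservation.Restated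

open Literature.Probability.LatticeModels
open Summit.CriticalPhenomena.Ising3DConformalLimit.Theses
open Summit.CriticalPhenomena.Ising3DConformalLimit.Theorems

/-! ## 1. The three hub decls of `VolterraWard` are the `HyperoctahedralRP` items verbatim -/

theorem hub_exists_iff :
    VolterraWard.ExistsScaleCovariantLimit ↔ HyperoctahedralRP.ExistsScaleCovariantLimit := Iff.rfl

theorem hub_inversion_iff :
    VolterraWard.InversionUpgradeNormalised ↔ HyperoctahedralRP.InversionUpgradeNormalised := Iff.rfl

theorem hub_u4_iff :
    VolterraWard.IsingEuclidUpgradeR4NonGaussian ↔ HyperoctahedralRP.IsingEuclidUpgradeR4NonGaussian := Iff.rfl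

/-! ## 2. The summit from the three hubs alone, and conversely -/

/-- `closes` needs only its three shared hub binders. -/
theorem summit_of_hubs (hE : VolterraWard.ExistsScaleCovariantLimit)
    (hI : VolterraWard.InversionUpgradeNormalised) (hU : VolterraWard.IsingEuclidUpgradeR4NonGaussian) :
    _root_.Ising3DConformalLimit :=
  LimitsAreConformalSummit.summit_iff_three_hubs.mpr ⟨hE, hI, hU⟩

/-- The load-bearing cone of the route IS the sub-problem: `1981 ∧ 1982 ∧ 0636 ↔ Ising3DConformalLimit`. -/
theorem hubs_iff_summit :
    (VolterraWard.ExistsScaleCovariantLimit ∧ VolterraWard.InversionUpgradeNormalised ∧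
        VolterraWard.IsingEuclidUpgradeR4NonGaussian) ↔ _root_.Ising3DConformalLimit :=
  LimitsAreConformalSummit.summit_iff_three_hubs.symm

/-! ## 3. The route's `Assembly` item holds with the whole Volterra block ignored -/

/-- Item stmt-CriticalPhenomena-7044 (`VolterraWard.Assembly`) — provable while DISCARDING the seven Volterra
antecedents: none of `CoreTransparency`, `TwistFluxConservation`, `WallCrossingContinuity`, `WallDecay`,
`VolterraGlue`, `AxialRotationToO3`, `LimitContinuous` is consumed. -/
theorem assembly_ignoring_volterra : VolterraWard.Assembly :=
  fun _core _inv _kin _decay _glue _axial _cont hE hI hU => summit_of_hubs hE hI hU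

/-! ## 4. The deciding theorem's exact type, consuming 3 of its 11 binders -/

/-- Same type as `VolterraWard.closes`; the binders `TwistFluxConservation`, `CoreTransparency`,
`WallCrossingContinuity`, `WallDecay`, `VolterraGlue`, `AxialRotationToO3`, `LimitContinuous`, `Assembly` are
unused (P4 `crux.hyp-unused` for each of them). -/
theorem closes_of_hubs_only :
    VolterraWard.TwistFluxConservation → VolterraWard.CoreTransparency → VolterraWard.WallCrossingContinuity →
      VolterraWard.WallDecay → VolterraWard.ExistsScaleCovariantLimit → VolterraWard.InversionUpgradeNormalised →
      VolterraWard.IsingEuclidUpgradeR4NonGaussian → VolterraWard.VolterraGlue → VolterraWard.AxialRotationToO3 →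
      VolterraWard.LimitContinuous → VolterraWard.Assembly → _root_.Ising3DConformalLimit :=
  fun _ _ _ _ hE hI hU _ _ _ _ => summit_of_hubs hE hI hU

/-! ## 5. The Volterra block's designed output is already a theorem of the tree -/

/-- Every normalised, non-degenerate, translation-invariant, scale-covariant pointwise scaling limit of
`criticalCorr 3` is `O(3)`-invariant — the tree theorem (items 1979 `HRP2Rigidity` and 1980
`LimitRotationInvariant` proved).  This is exactly the class of limits the route's `Assembly` feeds to
`VolterraGlue`/`AxialRotationToO3` (the witness of `ExistsScaleCovariantLimit`). -/
theorem volterra_output_in_tree {ρ : ℝ → ℝ} {Δ : ℝ} {S : CorrFamily 3}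
    (hρ : ∀ δ ∈ Set.Ioc (0:ℝ) 1, 0 < ρ δ) (hlim : HasPointwiseScalingLimit (criticalCorr 3) ρ S)
    (hnorm : ∀ n z, z ∉ NonCoincident 3 n → S n z = 0) (hnd : IsNondegenerateTwoPoint S)
    (htr : IsTranslationInvariant S) (hsc : IsScaleCovariant Δ S) : IsRotationInvariant S :=
  MoebiusLimitExistsTwoLeaf.isRotationInvariant_of_scaleCovariantLimit hρ hlim hnorm hnd htr hsc

/-- In particular the conclusion of `VolterraGlue` (invariance under the rotations about `e₃`, here even under
every linear isometry) holds for every such limit WITHOUT `TwistFluxConservation`, `WallCrossingContinuity`,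
`WallDecay` or continuity. -/
theorem volterraGlue_conclusion_in_tree {ρ : ℝ → ℝ} {Δ : ℝ} {S : CorrFamily 3}
    (hρ : ∀ δ ∈ Set.Ioc (0:ℝ) 1, 0 < ρ δ) (hlim : HasPointwiseScalingLimit (criticalCorr 3) ρ S)
    (hnorm : ∀ n z, z ∉ NonCoincident 3 n → S n z = 0) (hnd : IsNondegenerateTwoPoint S)
    (htr : IsTranslationInvariant S) (hsc : IsScaleCovariant Δ S)
    (R : EuclideanSpace ℝ (Fin 3) ≃ₗᵢ[ℝ] EuclideanSpace ℝ (Fin 3)) (n : ℕ)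
    (x : Fin n → EuclideanSpace ℝ (Fin 3)) : S n (fun i => R (x i)) = S n x :=
  volterra_output_in_tree hρ hlim hnorm hnd htr hsc n R x

/-- For the witness of the route's own hub `ExistsScaleCovariantLimit` the full Euclidean invariance that the
`Assembly` assembles from the Volterra block is in tree. -/
theorem euclidean_of_hub_witness (hE : VolterraWard.ExistsScaleCovariantLimit) :
    ∃ (ρ : ℝ → ℝ) (Δ : ℝ) (S : CorrFamily 3), (∀ δ ∈ Set.Ioc (0:ℝ) 1, 0 < ρ δ) ∧ 0 < Δ ∧
      HasPointwiseScalingLimit (criticalCorr 3) ρ S ∧ (∀ n z, z ∉ NonCoincident 3 n → S n z = 0) ∧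
      IsNondegenerateTwoPoint S ∧ IsEuclideanInvariant S ∧ IsScaleCovariant Δ S := by
  obtain ⟨ρ, Δ, S, hρ, hΔ, hlim, hnorm, hnd, htr, hsc⟩ := hE
  exact ⟨ρ, Δ, S, hρ, hΔ, hlim, hnorm, hnd, ⟨htr, volterra_output_in_tree hρ hlim hnorm hnd htr hsc⟩, hsc⟩

end Summit.CriticalPhenomena.Ising3DConformalLimit.Cruxes.TwistFluxConservation.Restated
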